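import Mathlib.Algebra.Order.BigOperators.Group.Finset
import Mathlib.Algebra.BigOperators.Intervals
import Mathlib.Algebra.BigOperators.NatAntidiagonal
import Summits.MatrixMultiplication.MatrixMultiplication.Theorems.FarEdgeDescentDialExtinctionDeep
import HarnessLib

/-!
# FarEdgeDescent — kernel XXXIX-K: the width cascade of a squaring tower (model level, def-free)

Helper kernel for `FarEdgeDescent.FiniteSaturation` (decomp-mm lens 2 «special vs generic», generation
59).  Kernel XXXIX-I (`FarEdgeDescentDialExtinctionDeep.squaring_tower_extinct_all`) proved the extinction
of squaring towers below `β = 2` from a HYPOTHESISED one-step bound on the width-class fractions,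
`F_{j}(k+1) ≤ F_{j}(k)·(2ρ + F_{j-1}(k))/(2ρ+1)`.  This file DERIVES that bound from the primitive
bookkeeping of the β-dial, so that extinction follows from the dial's clauses alone.

The primitive data of a squaring tower `O_{k+1} = O_k ⊗ O_k`: the anchor `Q_k`, and the leg mass
`M_k(e)` carried by legs of width `a^e` (`e ≥ 1`; `M_k(0) = 0`).  Squaring an anchored object
`⟨1,Q,1⟩ ⊕ ⊕_e (legs of width a^e, mass M(e))` gives anchor×anchor `⟨1,Q²,1⟩`, the dial's self-cancelling
clause contributes `β(β−1)L²` to the new anchor (XXXVIII-F), anchor×leg + leg×anchor keep the width and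
contribute `2Q·M(e)`, and leg×leg multiplies widths, contributing `Σ_{e'+e''=e} M(e')M(e'')`:
  `M_{k+1}(e) = 2Q_k M_k(e) + Σ_{e'+e''=e} M_k(e') M_k(e'')`,   `L_{k+1} = 2Q_k L_k + L_k²`,
  `Q_{k+1} = Q_k² + β(β−1) L_k²`,
with `L_k` the total leg mass (any sequence obeying the clause and dominating the partial sums
`Σ_{e<j} M_k(e)`; the total mass does both).

* `conv_below_le` — the leg×leg mass landing below exponent `j` is at most `b_{j−1}·b_j`
  (`b_j = Σ_{e<j} M(e)`): a product of widths `a^{e'}·a^{e''}` lies below `a^j` only if `e' < j−1`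
  (as `e'' ≥ 1`) and `e'' < j`.
* `ratio_step` — the anchor/leg ratio stays bounded: `Q_k ≤ ρ L_k` with `ρ = max(Q₀/L₀, β(β−1))`.
* `fraction_step_derived` — the one-step bound of XXXIX-I, derived.
* `squaring_tower_extinct_from_clauses` — for every `1 < β < 2`, `a > 1` and every squaring tower
  obeying the clauses, some node violates some Landsberg–Ottaviani node floor
  `Q + (2 − a^{−j})·(mass of legs of width ≥ a^j) ≤ budget = Q + βL` (XXXIX-G `anchored_lo_floor_wide`
  with `p + 1 = a^j`, read through the dial's dictionary).

MODEL-LEVEL THROUGHOUT (sequences of reals; the dictionary to tensors is XXXVIII's and XXXIX-G's and is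
not formalised here).  Route `FarEdgeDescent`, cut `closes (h₁ : FiniteSaturation) (h₂ : AnchoredLogConvexity)`
unchanged; this file supports h₁ (stmt-MatrixMultiplication-23739) as a helper and decides nothing.
-/

set_option linter.dupNamespace false

namespace Summit.MatrixMultiplication.MatrixMultiplication.Theorems.FarEdgeDescentDialWidthCascade

open Finset
open Summit.MatrixMultiplication.MatrixMultiplication.Theorems.FarEdgeDescentDialExtinctionDeep

/-- Reindexing: the leg×leg mass met below exponent `j`, `Σ_{e<j} Σ_{e'+e''=e} M(e')M(e'')`, equals
`Σ_{k<j} M(k)·Σ_{d<j−k} M(d)`. -/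
theorem conv_below_eq (M : ℕ → ℝ) (j : ℕ) :
    ∑ e ∈ range j, ∑ p ∈ antidiagonal e, M p.1 * M p.2 =
      ∑ k ∈ range j, M k * ∑ d ∈ range (j - k), M d := by
  have h1 : ∀ e, ∑ p ∈ antidiagonal e, M p.1 * M p.2 =
      ∑ k ∈ Ico 0 (e + 1), M k * M (e - k) := fun e => by
    rw [Finset.Nat.sum_antidiagonal_eq_sum_range_succ (fun x y => M x * M y) e, Finset.range_eq_Ico]
  simp_rw [h1]
  rw [Finset.range_eq_Ico, ← Finset.sum_Ico_Ico_comm]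
  refine Finset.sum_congr rfl fun k _ => ?_
  rw [← Finset.mul_sum, Finset.sum_Ico_eq_sum_range]
  refine congrArg _ (Finset.sum_congr rfl fun d _ => ?_)
  rw [Nat.add_sub_cancel_left]

/-- The leg×leg mass landing below exponent `j` is at most `b_{j−1} · b_j`, where `b_j = Σ_{e<j} M(e)`,
for nonnegative masses with no legs of width `a⁰` (`M 0 = 0`). -/
theorem conv_below_le (M : ℕ → ℝ) (h0 : ∀ e, 0 ≤ M e) (hz : M 0 = 0) (j : ℕ) :
    ∑ e ∈ range j, ∑ p ∈ antidiagonal e, M p.1 * M p.2 ≤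
      (∑ e ∈ range (j - 1), M e) * ∑ e ∈ range j, M e := by
  rw [conv_below_eq]
  cases j with
  | zero => simp
  | succ j' =>
    rw [Finset.sum_range_succ, Nat.add_sub_cancel, Finset.sum_mul]
    have hlast : M j' * ∑ d ∈ range (j' + 1 - j'), M d = 0 := by
      rw [Nat.add_sub_cancel_left, Finset.sum_range_one, hz, mul_zero]
    rw [hlast, add_zero]
    refine Finset.sum_le_sum fun k _ => ?_
    refine mul_le_mul_of_nonneg_left ?_ (h0 k)
    exact Finset.sum_le_sum_of_subset_of_nonneg (Finset.range_mono (Nat.sub_le _ _))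
      (fun d _ _ => h0 d)

/-- The anchor/leg ratio of a squaring tower stays bounded: if `Q ≤ ρL`, `β(β−1) ≤ ρ`, then
`Q² + β(β−1)L² ≤ ρ·(2QL + L²)`. -/
theorem ratio_step {β ρ Q L : ℝ} (hQ : 0 ≤ Q) (hc : β * (β - 1) ≤ ρ) (hρ : Q ≤ ρ * L) :
    Q ^ 2 + β * (β - 1) * L ^ 2 ≤ ρ * (2 * Q * L + L ^ 2) := by
  have h1 : Q ^ 2 ≤ ρ * L * Q := by nlinarith
  have h2 : 0 ≤ ρ * L * Q := le_trans (sq_nonneg Q) h1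
  nlinarith [mul_le_mul_of_nonneg_right hc (sq_nonneg L)]

/-- ONE SQUARING STEP, DERIVED.  From the primitive bookkeeping `M'(e) = 2Q·M(e) + Σ_{e'+e''=e} M(e')M(e'')`
with `M ≥ 0`, `M 0 = 0`, partial sums dominated by `L`, and `Q ≤ ρL`: the fraction of leg mass below
exponent `j+2` after squaring (new total `2QL + L²`) is at most `F_{j+2}·(2ρ + F_{j+1})/(2ρ+1)`. -/
theorem fraction_step_derived {Q L ρ : ℝ} (M M' : ℕ → ℝ) (hQ : 0 < Q) (hL : 0 < L)
    (h0 : ∀ e, 0 ≤ M e) (hz : M 0 = 0)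
    (hrec : ∀ e, M' e = 2 * Q * M e + ∑ p ∈ antidiagonal e, M p.1 * M p.2)
    (hdom : ∀ j, ∑ e ∈ range j, M e ≤ L) (hρ : Q ≤ ρ * L) (j : ℕ) :
    (∑ e ∈ range (j + 2), M' e) / (2 * Q * L + L ^ 2) ≤
      (∑ e ∈ range (j + 2), M e) / L * (2 * ρ + (∑ e ∈ range (j + 1), M e) / L) / (2 * ρ + 1) := by
  set b : ℝ := ∑ e ∈ range (j + 2), M e with hb
  set b' : ℝ := ∑ e ∈ range (j + 1), M e with hb'
  have hb0 : 0 ≤ b := Finset.sum_nonneg fun e _ => h0 e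
  have hb'L : b' ≤ L := hdom _
  set u : ℝ := b / L with hu
  set u' : ℝ := b' / L with hu'
  have hbu : b = u * L := by rw [hu, div_mul_cancel₀ _ hL.ne']
  have hbu' : b' = u' * L := by rw [hu', div_mul_cancel₀ _ hL.ne']
  have hu0 : 0 ≤ u := div_nonneg hb0 hL.le
  have hu'1 : u' ≤ 1 := (div_le_one hL).2 hb'L
  have hρ0 : 0 < ρ := by
    by_contra h
    have : ρ * L ≤ 0 := mul_nonpos_of_nonpos_of_nonneg (not_lt.1 h) hL.le
    linarith
  have hden : 0 < 2 * Q * L + L ^ 2 := by positivity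
  -- numerator bound
  have hnum : ∑ e ∈ range (j + 2), M' e ≤ 2 * Q * b + b' * b := by
    have hsplit : ∑ e ∈ range (j + 2), M' e =
        2 * Q * b + ∑ e ∈ range (j + 2), ∑ p ∈ antidiagonal e, M p.1 * M p.2 := by
      simp_rw [hrec]
      rw [Finset.sum_add_distrib, ← Finset.mul_sum]
    rw [hsplit]
    have hconv := conv_below_le M h0 hz (j + 2)
    rw [show j + 2 - 1 = j + 1 by omega] at hconv
    linarith
  calc (∑ e ∈ range (j + 2), M' e) / (2 * Q * L + L ^ 2)
      ≤ (2 * Q * b + b' * b) / (2 * Q * L + L ^ 2) := div_le_div_of_nonneg_right hnum hden.le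
    _ ≤ u * (2 * ρ + u') / (2 * ρ + 1) := by
        rw [hbu, hbu', div_le_div_iff₀ hden (by positivity)]
        -- RHS − LHS = 2·uL·(1 − u')·(ρL − Q) ≥ 0
        have hkey : 0 ≤ u * L * ((1 - u') * (ρ * L - Q)) :=
          mul_nonneg (mul_nonneg hu0 hL.le) (mul_nonneg (by linarith) (by linarith))
        nlinarith [hkey]

/-- EXTINCTION FROM THE CLAUSES ALONE.  A squaring tower of the β-dial (`1 < β < 2`), recorded by its anchor
`Q_k`, total leg mass `L_k` and width-class masses `M_k(e)` (legs of width `a^e`, `a > 1`, none of width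
`a⁰`), obeying the primitive bookkeeping
`M_{k+1}(e) = 2Q_k M_k(e) + Σ_{e'+e''=e} M_k(e')M_k(e'')`, `L_{k+1} = 2Q_k L_k + L_k²`,
`Q_{k+1} = Q_k² + β(β−1)L_k²`, with `L_k` dominating the partial sums of `M_k`, violates at some node `k`
and some depth `j` the node floor «anchor + (2 − a^{−j})·(leg mass of width ≥ a^j) ≤ budget Q_k + βL_k»:
the claimed budget is too small for the Landsberg–Ottaviani floor of XXXIX-G.  For `β = 2` no such
conclusion is possible (every floor is `≤ Q + 2L`): Schönhage's corner is exactly the boundary. -/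
theorem squaring_tower_extinct_from_clauses {β a : ℝ} (ha : 1 < a) (hβ1 : 1 < β) (hβ : β < 2)
    (Q L : ℕ → ℝ) (M : ℕ → ℕ → ℝ) (hQ0 : 0 < Q 0) (hL0 : 0 < L 0)
    (h0 : ∀ k e, 0 ≤ M k e) (hz : ∀ k, M k 0 = 0)
    (hdom : ∀ k j, ∑ e ∈ range j, M k e ≤ L k)
    (hM : ∀ k e, M (k + 1) e = 2 * Q k * M k e + ∑ p ∈ antidiagonal e, M k p.1 * M k p.2)
    (hL : ∀ k, L (k + 1) = 2 * Q k * L k + L k ^ 2)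
    (hQ : ∀ k, Q (k + 1) = Q k ^ 2 + β * (β - 1) * L k ^ 2) :
    ∃ j k, Q k + β * L k < Q k + (2 - 1 / a ^ j) * (L k - ∑ e ∈ range j, M k e) := by
  -- positivity along the tower
  have hLpos : ∀ k, 0 < L k := by
    intro k
    induction k with
    | zero => exact hL0
    | succ k ih =>
      rw [hL]
      have hQk : 0 ≤ Q k := by
        clear ih
        induction k with
        | zero => exact hQ0.le
        | succ k ih2 =>
          rw [hQ]
          have hββ : 0 ≤ β * (β - 1) := mul_nonneg (by linarith) (by linarith)
          nlinarith [sq_nonneg (Q k), mul_nonneg hββ (sq_nonneg (L k))]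
      positivity
  have hQpos : ∀ k, 0 < Q k := by
    intro k
    induction k with
    | zero => exact hQ0
    | succ k ih =>
      rw [hQ]
      have hββ : 0 ≤ β * (β - 1) := mul_nonneg (by linarith) (by linarith)
      nlinarith [mul_nonneg hββ (sq_nonneg (L k)), pow_pos ih 2]
  -- bounded anchor/leg ratio
  set ρ : ℝ := max (Q 0 / L 0) (β * (β - 1)) with hρdef
  have hc : β * (β - 1) ≤ ρ := le_max_right _ _
  have hρpos : 0 < ρ := lt_of_lt_of_le (by nlinarith) hc
  have hratio : ∀ k, Q k ≤ ρ * L k := by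
    intro k
    induction k with
    | zero =>
      have : Q 0 / L 0 ≤ ρ := le_max_left _ _
      rwa [div_le_iff₀ hL0] at this
    | succ k ih =>
      rw [hQ, hL]
      exact ratio_step (hQpos k).le hc ih
  -- the width-class fractions
  set F : ℕ → ℕ → ℝ := fun j k => (∑ e ∈ range j, M k e) / L k with hF
  have hF0 : ∀ j k, 0 ≤ F j k := fun j k => div_nonneg (Finset.sum_nonneg fun e _ => h0 k e) (hLpos k).le
  have hF1 : ∀ j k, F j k ≤ 1 := fun j k => (div_le_one (hLpos k)).2 (hdom k j)
  have hF10 : ∀ k, F 1 k = 0 := fun k => by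
    show (∑ e ∈ range 1, M k e) / L k = 0
    rw [Finset.sum_range_one, hz, zero_div]
  have hFrec : ∀ j k, F (j + 2) (k + 1) ≤ F (j + 2) k * (2 * ρ + F (j + 1) k) / (2 * ρ + 1) := by
    intro j k
    show (∑ e ∈ range (j + 2), M (k + 1) e) / L (k + 1) ≤
      (∑ e ∈ range (j + 2), M k e) / L k * (2 * ρ + (∑ e ∈ range (j + 1), M k e) / L k) / (2 * ρ + 1)
    rw [hL]
    exact fraction_step_derived (M k) (M (k + 1)) (hQpos k) (hLpos k) (h0 k) (hz k) (hM k) (hdom k)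
      (hratio k) j
  obtain ⟨j, k, hjk⟩ := squaring_tower_extinct_all ha hβ hρpos F hF0 hF1 hF10 hFrec L hLpos
  refine ⟨j, k, ?_⟩
  have hrew : (1 - F j k) * L k = L k - ∑ e ∈ range j, M k e := by
    show (1 - (∑ e ∈ range j, M k e) / L k) * L k = L k - ∑ e ∈ range j, M k e
    rw [sub_mul, one_mul, div_mul_cancel₀ _ (hLpos k).ne']
  rw [hrew] at hjk
  linarith

end Summit.MatrixMultiplication.MatrixMultiplication.Theorems.FarEdgeDescentDialWidthCascade
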